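import Literature.NumberTheory.ComplexMultiplication.CMAlgebraTorusIsomorphismClassesLatticeClasses
import HarnessLib

/-!
# «`ICM(R) ⊇ ⊔_S Pic(S)` … the ideal class monoid is partitioned by the multiplicator rings» and «between a given order
# `Λ` and the maximal order `Λ_max(A)` there are only finitely many orders»: the `ε`-classes of full lattices
# `M ⊂ Y = L_1 ⊕ ⋯ ⊕ L_t` with `M𝔯 ⊆ M` are the DISJOINT UNION, over the finitely many over-orders `S ⊇ 𝔯`, of the
# classes with order EXACTLY `S` — and so are the `Y`-isomorphism classes of CM-algebra tori with order `⊇ 𝔯`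
# (Marseglia 2020 §3–§4; Hertling–Larabi 2026 Cor. 6.2 (a), Rem. 6.6 (i); Shimura 1998 §7.1 — torus level)

Topic `Literature/NumberTheory/ComplexMultiplication`, namespace `Literature.NumberTheory.ComplexMultiplication`;
lane `lit-hodgefound` (Track 2 foundations library), Layer A3 («CM abelian varieties: construction from a CM type,
Shimura–Taniyama basics»), seat p19 generation 31, row g31-#4 — sequel of g31-#1 (`CMAlgebraLatticeClassesFinite`:
the tree's `IsFullLattice`, units of `Y` acting on `Submodule ℤ Y`, Jordan–Zassenhaus) and g31-#2
(`CMAlgebraTorusIsomorphismClassesLatticeClasses`: the class sets with order `⊇ 𝔯` resp. `= S`, both for lattices and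
for the sublattice models `(X_A, ρ_A)` of a reference torus; `exists_forall_mul_smul_mem_of_isFullLattice`:
`𝒪(M) ⊇ n𝒪_Y`).  The one-field companion is `CMOrderIdealClassMonoidOverorderCount` (`#ICM(𝔯) = Σ_S #ICM_S(𝔯)` with
`FractionalIdeal`s of an order of a number FIELD); here `Y` is a product of number fields and lattices are
`ℤ`-submodules.  THEOREMS ONLY: no definition, no instance, no named fact (D-0026, net Literature debt `0`), no `sorry`;
the order `𝒪(M) = {a ∈ Y | Ma ⊆ M}` of a lattice is never named — it enters through the predicate
`∀ a, (∀ m ∈ M, m·a ∈ M) ⟺ a ∈ S` («`M` has order exactly `S`»).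

## Sources, VERBATIM

* S. Marseglia, *Computing the ideal class monoid of an order*, J. Lond. Math. Soc. 101 (2020) [Marseglia2019], §2
  (p. 4): «for a fractional `R`-ideal `I`, the multiplicator ring `(I : I)` is an over-order of `R`»; §3 (p. 6):
  «`ICM(R) ⊇ ⊔_{S} Pic(S)` where the disjoint union is taken over the over-orders `S` of `R` […] with equality if and
  only if `R` is Bass»; §4 (p. 8): the computation of `ICM(R)` «over-order by over-order»: `ICM(R)` is the disjoint
  union of the sets `ICM_S(R)` of classes with multiplicator ring `S`, `S` running over the (finitely many) over-orders
  of `R`.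
* C. Hertling, K. Larabi, arXiv:2602.14973 (2026) [HertlingLarabi2026], held `paper:arxiv-2602.14973`, §6 (chunk
  p0015): «Corollary 6.2. (a) `A` has a maximal order `Λ_max(A)`, which contains all other orders. […] Remarks 6.6.
  (i) In the case of a separable algebra `A`, Theorem 6.5 is equivalent to Theorem 6.3 because between a given order
  `Λ` and the maximal order `Λ_max(A)` there are only finitely many orders.»; §1 (chunk p0003): «For each full lattice
  `L` in `A`, `𝒪(L) := L : L` is an order and is called the order of `L`.»
* G. Shimura, *Abelian Varieties with Complex Multiplication and Modular Functions* (Princeton 1998) [Shimura1998],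
  §7.1 p. 47: «`𝔯 = ι⁻¹[End(A) ∩ ι(𝔎)]` is an order in `𝔎` […] we call `𝔯` the order of `(A, ι)`».

## What is proved (`Y = ∏ᵢ Lᵢ` number fields; `𝒪_Y` = vectors of algebraic integers; `𝔯 ⊂ Y` a subring)

* §1 THE ORDER OF A FULL LATTICE IS AN ORDER: `isIntegral_of_forall_mul_mem` (if `Ma ⊆ M` for a full `M` then `a`
  is integral — «`𝒪(L)` is an order», «`Λ_max` contains all other orders»: `𝒪(M) ⊆ (k·1)⁻¹M` is finitely
  generated), `isIntegral_apply_of_forall_mul_mem` (componentwise).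
* §2 FINITELY MANY OVER-ORDERS: `finite_setOf_subring_integral_of_forall_smul_mem` (the subrings `S` with
  `n𝒪_Y ⊆ S ⊆ 𝒪_Y`, `n ≠ 0`, are finitely many — window finiteness of g31-#1's source file),
  `finite_setOf_subring_exists_order_eq` (hence finitely many `S ⊇ 𝔯` occur as the exact order of a full lattice,
  when `𝔯 ⊇ n𝒪_Y`).
* §3 THE PARTITION **`nonempty_quot_le_equiv_sigma_quot_order_eq`**: for ANY subring `𝔯`, `[M] ↦ ⟨𝒪(M), [M]⟩` is a
  bijection `{[M] : M full, M𝔯 ⊆ M} ≃ Σ_{S ⊇ 𝔯} {[M] : M full, 𝒪(M) = S}` («`ICM(R) = ⊔_S ICM_S(R)`»); counted,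
  **`exists_finset_natCard_quot_le_eq_sum`**: if `𝔯 ⊇ n𝒪_Y` there is a finite set `𝓢` of over-orders `S ⊇ 𝔯` with
  `#{[M] : M𝔯 ⊆ M} = Σ_{S ∈ 𝓢} #{[M] : 𝒪(M) = S}`.
* §4 THE TORI: **`IsCMAlgTorusRat.nonempty_quot_sublattice_le_order_equiv_sigma`** — the `Y`-isomorphism classes of
  the models `(X_A, ρ_A)` of type `(Y; (Φᵢ))` whose order `ρ_A⁻¹(M_ι(ℤ))` CONTAINS `𝔯` are the disjoint union over
  the over-orders `S ⊇ 𝔯` of the classes whose order IS `S` («the order of `(A, ι)`»; g31-#2's two dictionaries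
  glued by §3), and **`IsCMAlgTorusRat.exists_finset_natCard_quot_sublattice_le_order_eq_sum`** (`𝔯 ⊇ n𝒪_Y`: a finite
  sum over over-orders).

## References
* [Marseglia2019] S. Marseglia, J. LMS 101 (2020), §2 p. 4, §3 p. 6, §4 p. 8. [cite: Marseglia2019, §3–§4, pp. 6–8]
* [HertlingLarabi2026] C. Hertling, K. Larabi, arXiv:2602.14973 (2026), §1 (chunk p0003), §6 Cor. 6.2 (a),
  Rem. 6.6 (i) (chunk p0015). [cite: HertlingLarabi2026, §6 Rem. 6.6 (i), chunk p0015]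
* [Shimura1998] G. Shimura, Princeton 1998, §7.1 p. 47. [cite: Shimura1998, §7.1, p. 47]
* [DadeTausskyZassenhaus1962] E. C. Dade, O. Taussky, H. Zassenhaus, Math. Ann. 148 (1962) (orders and their
  over-orders; the semigroup of ideal classes). [cite: DadeTausskyZassenhaus1962, title theorem]
-/

noncomputable section

open scoped Classical Matrix Pointwise nonZeroDivisors NumberField
open Module Matrix NumberField Function

namespace Literature.NumberTheory.ComplexMultiplication

open Literature.NumberTheory.Automorphic
open Literature.AlgebraicGeometry.Motives (CMType)
open Literature.Geometry.Kaehler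
open Literature.Geometry.Kaehler.ComplexTorus

/-! ## §1 The order of a full lattice is an order: `Ma ⊆ M ⟹ a` integral -/

section Order

variable {t : Type} {L : t → Type} [∀ i, Field (L i)] [∀ i, NumberField (L i)] [Fintype t] [DecidableEq t]

omit [Fintype t] [DecidableEq t] in
/-- **«`𝒪(L) := L : L` is an order», so `𝒪(L) ⊆ Λ_max`: if `M ⊂ Y` is a full lattice and `Ma ⊆ M`, then `a` is
integral over `ℤ`.**  Proof: `k·1 ∈ M` for some integer `k ≠ 0`, so `𝒪(M) ⊆ (k·1)⁻¹M` is a finitely generated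
`ℤ`-module closed under multiplication, whose elements are therefore integral. [cite: HertlingLarabi2026, §1 («`𝒪(L) := L : L` is an order»), chunk p0003; §6 Cor. 6.2 (a) («`Λ_max(A)` … contains all other orders»), chunk p0015]
[cite: Marseglia2019, §2 («the multiplicator ring `(I : I)` is an over-order of `R`»), p. 4] -/
theorem isIntegral_of_forall_mul_mem {M : Submodule ℤ (Π i, L i)} (hM : IsFullLattice (Π i, L i) M)
    {a : Π i, L i} (ha : ∀ m ∈ M, m * a ∈ M) : IsIntegral ℤ a := by
  -- the `ℤ`-subalgebra `𝒪(M)`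
  let O : Subalgebra ℤ (Π i, L i) :=
    { carrier := {b | ∀ m ∈ M, m * b ∈ M}
      mul_mem' := fun {b c} hb hc m hm => by rw [← mul_assoc]; exact hc _ (hb m hm)
      one_mem' := fun m hm => by rw [mul_one]; exact hm
      add_mem' := fun {b c} hb hc m hm => by rw [mul_add]; exact M.add_mem (hb m hm) (hc m hm)
      zero_mem' := fun m _ => by rw [mul_zero]; exact M.zero_mem
      algebraMap_mem' := fun k m hm => by
        rw [Algebra.algebraMap_eq_smul_one, mul_smul_comm, mul_one]
        exact M.smul_mem k hm }
  -- `k·1 ∈ M`, `k ≠ 0`; `𝒪(M) ⊆ u • M` for the unit `u = (k·1)⁻¹`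
  obtain ⟨k, hk, hk1⟩ := hM.2 1
  have hku : IsUnit ((k : ℤ) • (1 : Π i, L i)) := by
    rw [zsmul_eq_mul, mul_one, ← map_intCast (algebraMap ℚ (Π i, L i)) k]
    exact (((Int.cast_ne_zero (α := ℚ)).2 hk).isUnit).map _
  have hle : Subalgebra.toSubmodule O ≤ hku.unit⁻¹ • M := by
    intro b hb
    rw [mem_units_smul_submodule_iff, inv_inv, Units.smul_def, IsUnit.unit_spec, smul_eq_mul]
    exact hb _ hk1
  have hfg : (Subalgebra.toSubmodule O).FG := by
    refine Submodule.FG.of_le ?_ hle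
    rw [Units.smul_def]
    exact hM.1.map _
  exact IsIntegral.of_mem_of_fg O hfg a ha

omit [Fintype t] [DecidableEq t] in
/-- Componentwise: `Ma ⊆ M` for a full `M` forces every `aᵢ` to be an algebraic integer (`𝒪(M) ⊆ 𝒪_Y = ⊕ᵢ 𝒪_{Lᵢ}`).
[cite: HertlingLarabi2026, §6 Cor. 6.2 (a), chunk p0015] [cite: Shimura1998, §7.1 («`𝔯` is an order in `𝔎`»), p. 47] -/
theorem isIntegral_apply_of_forall_mul_mem {M : Submodule ℤ (Π i, L i)} (hM : IsFullLattice (Π i, L i) M)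
    {a : Π i, L i} (ha : ∀ m ∈ M, m * a ∈ M) (i : t) : IsIntegral ℤ (a i) :=
  (isIntegral_of_forall_mul_mem hM ha).map (Pi.evalAlgHom ℤ L i)

end Order

/-! ## §2 «Between a given order `Λ` and the maximal order there are only finitely many orders» -/

section Overorders

variable {t : Type} {L : t → Type} [∀ i, Field (L i)] [∀ i, NumberField (L i)] [Fintype t] [DecidableEq t]

omit [DecidableEq t] in
/-- **Finitely many subrings `S` of `Y` with `n𝒪_Y ⊆ S ⊆ 𝒪_Y`** (`n ≠ 0`): as additive groups they lie between
`n𝒪_Y` and the finitely generated `𝒪_Y` (window finiteness). [cite: HertlingLarabi2026, §6 Rem. 6.6 (i) («between a given order `Λ` and the maximal order `Λ_max(A)` there are only finitely many orders»), chunk p0015]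
[cite: Marseglia2019, §2 (over-orders), p. 4] -/
theorem finite_setOf_subring_integral_of_forall_smul_mem {n : ℤ} (hn : n ≠ 0) :
    {S : Subring (Π i, L i) | (∀ a : Π i, L i, (∀ i, IsIntegral ℤ (a i)) → n • a ∈ S) ∧
      ∀ a ∈ S, ∀ i, IsIntegral ℤ (a i)}.Finite := by
  have hW := finite_setOf_le_and_smul_mem
    (Submodule.pi Set.univ (fun i => Subalgebra.toSubmodule (integralClosure ℤ (L i))))
    (isFullLattice_piIntegralSubmodule (L := L)).1 hn
  refine Set.Finite.of_finite_image (f := fun S : Subring (Π i, L i) => AddSubgroup.toIntSubmodule S.toAddSubgroup)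
    (hW.subset ?_) fun S _ S' _ hSS' => ?_
  · rintro _ ⟨S, ⟨hnS, hSint⟩, rfl⟩
    refine ⟨fun a ha => mem_piIntegralSubmodule_iff.2 (hSint a ha), fun x hx => ?_⟩
    exact hnS x (mem_piIntegralSubmodule_iff.1 hx)
  · exact Subring.ext fun a => by
      have h := congrArg (fun P : Submodule ℤ (Π i, L i) => a ∈ P) hSS'
      exact Iff.of_eq h

omit [DecidableEq t] in
/-- **Finitely many over-orders `S ⊇ 𝔯` occur as the exact order of a full lattice** when `𝔯 ⊇ n𝒪_Y` (`n ≠ 0`):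
such an `S` satisfies `n𝒪_Y ⊆ 𝔯 ⊆ S ⊆ 𝒪_Y` (§1). [cite: HertlingLarabi2026, §6 Rem. 6.6 (i), chunk p0015] [cite: Marseglia2019, §3–§4 (the over-orders of `R`), pp. 6–8] -/
theorem finite_setOf_subring_exists_order_eq (𝔯 : Subring (Π i, L i)) {n : ℤ} (hn : n ≠ 0)
    (hn𝔯 : ∀ a : Π i, L i, (∀ i, IsIntegral ℤ (a i)) → n • a ∈ 𝔯) :
    {S : Subring (Π i, L i) | 𝔯 ≤ S ∧ ∃ M : Submodule ℤ (Π i, L i), IsFullLattice (Π i, L i) M ∧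
      ∀ a : Π i, L i, (∀ m ∈ M, m * a ∈ M) ↔ a ∈ S}.Finite := by
  refine (finite_setOf_subring_integral_of_forall_smul_mem (L := L) hn).subset ?_
  rintro S ⟨h𝔯S, M, hM, hS⟩
  exact ⟨fun a ha => h𝔯S (hn𝔯 a ha), fun a ha => isIntegral_apply_of_forall_mul_mem hM ((hS a).2 ha)⟩

end Overorders

/-! ## §3 The partition of the classes with order `⊇ 𝔯` by their exact order -/

section Partition

variable {t : Type} {L : t → Type} [∀ i, Field (L i)] [∀ i, NumberField (L i)] [Fintype t] [DecidableEq t]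

omit [Fintype t] [DecidableEq t] [∀ i, NumberField (L i)] in
/-- **«`ICM(R) = ⊔_S ICM_S(R)`» FOR LATTICE CLASSES: `[M] ↦ ⟨𝒪(M), [M]⟩` is a bijection from the `ε`-classes of full
lattices `M ⊂ Y` with `M𝔯 ⊆ M` onto the disjoint union, over the subrings `S ⊇ 𝔯`, of the `ε`-classes of full
lattices with order EXACTLY `S`** (`𝒪(u•M) = 𝒪(M)`; `𝒪(M) ⊇ 𝔯`; for ANY subring `𝔯` — only finitely many `S` have a
nonempty fibre when `𝔯 ⊇ n𝒪_Y`, §2). [cite: Marseglia2019, §3 («`ICM(R) ⊇ ⊔_S Pic(S)` … over the over-orders `S` of `R`»), p. 6; §4, p. 8]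
[cite: HertlingLarabi2026, §1 («`𝒪(L) := L : L` … the order of `L`»), chunk p0003] -/
theorem nonempty_quot_le_equiv_sigma_quot_order_eq (𝔯 : Subring (Π i, L i)) :
    Nonempty (Quot (fun M M' : {M : Submodule ℤ (Π i, L i) //
          IsFullLattice (Π i, L i) M ∧ ∀ m ∈ M, ∀ a ∈ 𝔯, m * a ∈ M} =>
        ∃ u : (Π i, L i)ˣ, u • (M : Submodule ℤ (Π i, L i)) = M') ≃
      Σ S : {S : Subring (Π i, L i) // 𝔯 ≤ S}, Quot (fun M M' : {M : Submodule ℤ (Π i, L i) //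
          IsFullLattice (Π i, L i) M ∧ ∀ a : Π i, L i, (∀ m ∈ M, m * a ∈ M) ↔ a ∈ (S : Subring (Π i, L i))} =>
        ∃ u : (Π i, L i)ˣ, u • (M : Submodule ℤ (Π i, L i)) = M')) := by
  -- the order `𝒪(M)` of a lattice, as a subring containing `𝔯`
  let ord : {M : Submodule ℤ (Π i, L i) // IsFullLattice (Π i, L i) M ∧ ∀ m ∈ M, ∀ a ∈ 𝔯, m * a ∈ M} →
      {S : Subring (Π i, L i) // 𝔯 ≤ S} := fun M =>
    ⟨{ carrier := {a | ∀ m ∈ (M : Submodule ℤ (Π i, L i)), m * a ∈ (M : Submodule ℤ (Π i, L i))}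
       mul_mem' := fun {a b} ha hb m hm => by rw [← mul_assoc]; exact hb _ (ha m hm)
       one_mem' := fun m hm => by rw [mul_one]; exact hm
       add_mem' := fun {a b} ha hb m hm => by rw [mul_add]; exact M.1.add_mem (ha m hm) (hb m hm)
       zero_mem' := fun m _ => by rw [mul_zero]; exact M.1.zero_mem
       neg_mem' := fun {a} ha m hm => by rw [mul_neg]; exact M.1.neg_mem (ha m hm) },
      fun a ha m hm => M.2.2 m hm a ha⟩
  have hord_mem : ∀ M a, a ∈ ((ord M : {S : Subring (Π i, L i) // 𝔯 ≤ S}) : Subring (Π i, L i)) ↔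
      ∀ m ∈ (M : Submodule ℤ (Π i, L i)), m * a ∈ (M : Submodule ℤ (Π i, L i)) := fun M a => Iff.rfl
  -- `𝒪` is constant on `ε`-classes
  have hord : ∀ M M' : {M : Submodule ℤ (Π i, L i) // IsFullLattice (Π i, L i) M ∧ ∀ m ∈ M, ∀ a ∈ 𝔯, m * a ∈ M},
      (∃ u : (Π i, L i)ˣ, u • (M : Submodule ℤ (Π i, L i)) = M') → ord M = ord M' := by
    rintro M M' ⟨u, hu⟩
    refine Subtype.ext (Subring.ext fun a => ?_)
    rw [hord_mem, hord_mem, ← hu, forall_mul_mem_units_smul_iff]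
  let π := Quot.lift ord hord
  -- the fibre of `π` over `S` is the class set with order exactly `S`
  have hfib : ∀ S : {S : Subring (Π i, L i) // 𝔯 ≤ S},
      Nonempty (Quot (fun M M' : {M : Submodule ℤ (Π i, L i) //
          IsFullLattice (Π i, L i) M ∧ ∀ a : Π i, L i, (∀ m ∈ M, m * a ∈ M) ↔ a ∈ (S : Subring (Π i, L i))} =>
        ∃ u : (Π i, L i)ˣ, u • (M : Submodule ℤ (Π i, L i)) = M') ≃ {c // π c = S}) := by
    intro S
    -- inclusion of representatives
    let incl : {M : Submodule ℤ (Π i, L i) //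
        IsFullLattice (Π i, L i) M ∧ ∀ a : Π i, L i, (∀ m ∈ M, m * a ∈ M) ↔ a ∈ (S : Subring (Π i, L i))} →
        {M : Submodule ℤ (Π i, L i) // IsFullLattice (Π i, L i) M ∧ ∀ m ∈ M, ∀ a ∈ 𝔯, m * a ∈ M} :=
      fun N => ⟨N.1, N.2.1, fun m hm a ha => (N.2.2 a).2 (S.2 ha) m hm⟩
    have hincl : ∀ N, π (Quot.mk _ (incl N)) = S := fun N => by
      change ord (incl N) = S
      exact Subtype.ext (Subring.ext fun a => by rw [hord_mem]; exact N.2.2 a)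
    let G : Quot (fun M M' : {M : Submodule ℤ (Π i, L i) //
          IsFullLattice (Π i, L i) M ∧ ∀ a : Π i, L i, (∀ m ∈ M, m * a ∈ M) ↔ a ∈ (S : Subring (Π i, L i))} =>
        ∃ u : (Π i, L i)ˣ, u • (M : Submodule ℤ (Π i, L i)) = M') → {c // π c = S} :=
      Quot.lift (fun N => ⟨Quot.mk _ (incl N), hincl N⟩) fun N N' h => Subtype.ext (Quot.sound (by
        obtain ⟨u, hu⟩ := h
        exact ⟨u, hu⟩))
    refine ⟨Equiv.ofBijective G ⟨fun x y hxy => ?_, fun c => ?_⟩⟩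
    · induction x using Quot.ind with
      | mk N =>
        induction y using Quot.ind with
        | mk N' =>
          have h1 : Quot.mk _ (incl N) = Quot.mk _ (incl N') := congrArg Subtype.val hxy
          have h2 : ∃ u : (Π i, L i)ˣ, u • ((incl N : {M : Submodule ℤ (Π i, L i) //
              IsFullLattice (Π i, L i) M ∧ ∀ m ∈ M, ∀ a ∈ 𝔯, m * a ∈ M}) : Submodule ℤ (Π i, L i)) = (incl N' : _) :=
            (IsCMAlgTorusRat.equivalence_exists_units_smul_eq (L := L)
              (fun M => IsFullLattice (Π i, L i) M ∧ ∀ m ∈ M, ∀ a ∈ 𝔯, m * a ∈ M)).eqvGen_iff.1 (Quot.eqvGen_exact h1)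
          exact Quot.sound h2
    · obtain ⟨c, hc⟩ := c
      induction c using Quot.ind with
      | mk M =>
        have hS : ∀ a : Π i, L i, (∀ m ∈ (M : Submodule ℤ (Π i, L i)), m * a ∈ (M : Submodule ℤ (Π i, L i))) ↔
            a ∈ (S : Subring (Π i, L i)) := fun a => by
          rw [← hord_mem M a]
          change ord M = S at hc
          rw [hc]
        exact ⟨Quot.mk _ ⟨M.1, M.2.1, hS⟩, Subtype.ext rfl⟩
  exact ⟨(Equiv.sigmaFiberEquiv π).symm.trans (Equiv.sigmaCongrRight fun S => (hfib S).some.symm)⟩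

omit [DecidableEq t] in
/-- **`#{[M] : M𝔯 ⊆ M} = Σ_{S ∈ 𝓢} #{[M] : 𝒪(M) = S}` for a finite set `𝓢` of over-orders `S ⊇ 𝔯`**, whenever
`𝔯 ⊇ n𝒪_Y` (`n ≠ 0`): only finitely many fibres of §3's partition are nonempty (§2), and each is finite (g31-#2
`finite_quot_isFullLattice_order_eq`) — «`#ICM(R) = Σ_S #ICM_S(R)`» at lattice level for `Y`.
[cite: Marseglia2019, §3–§4 (`ICM(R)` as the disjoint union of the `ICM_S(R)` over the finitely many over-orders), pp. 6–8] [cite: HertlingLarabi2026, §6 Rem. 6.6 (i), chunk p0015] -/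
theorem exists_finset_natCard_quot_le_eq_sum (𝔯 : Subring (Π i, L i)) {n : ℤ} (hn : n ≠ 0)
    (hn𝔯 : ∀ a : Π i, L i, (∀ i, IsIntegral ℤ (a i)) → n • a ∈ 𝔯) :
    ∃ 𝓢 : Finset (Subring (Π i, L i)), (∀ S ∈ 𝓢, 𝔯 ≤ S) ∧
      Nat.card (Quot (fun M M' : {M : Submodule ℤ (Π i, L i) //
          IsFullLattice (Π i, L i) M ∧ ∀ m ∈ M, ∀ a ∈ 𝔯, m * a ∈ M} =>
        ∃ u : (Π i, L i)ˣ, u • (M : Submodule ℤ (Π i, L i)) = M')) =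
      ∑ S ∈ 𝓢, Nat.card (Quot (fun M M' : {M : Submodule ℤ (Π i, L i) //
          IsFullLattice (Π i, L i) M ∧ ∀ a : Π i, L i, (∀ m ∈ M, m * a ∈ M) ↔ a ∈ S} =>
        ∃ u : (Π i, L i)ˣ, u • (M : Submodule ℤ (Π i, L i)) = M')) := by
  obtain ⟨e⟩ := nonempty_quot_le_equiv_sigma_quot_order_eq (L := L) 𝔯
  -- the finite set of over-orders realised as exact orders
  have hT := finite_setOf_subring_exists_order_eq (L := L) 𝔯 hn hn𝔯
  refine ⟨hT.toFinset, fun S hS => ((Set.Finite.mem_toFinset hT).1 hS).1, ?_⟩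
  -- restrict the index of the disjoint union to that finite set
  let F : {S : Subring (Π i, L i) // 𝔯 ≤ S} → Type := fun S => Quot (fun M M' : {M : Submodule ℤ (Π i, L i) //
      IsFullLattice (Π i, L i) M ∧ ∀ a : Π i, L i, (∀ m ∈ M, m * a ∈ M) ↔ a ∈ (S : Subring (Π i, L i))} =>
    ∃ u : (Π i, L i)ˣ, u • (M : Submodule ℤ (Π i, L i)) = M')
  have hq : ∀ S : {S : Subring (Π i, L i) // 𝔯 ≤ S}, F S → (S : Subring (Π i, L i)) ∈ hT.toFinset := by
    intro S c
    obtain ⟨M, -⟩ := Quot.exists_rep c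
    exact (Set.Finite.mem_toFinset hT).2 ⟨S.2, M.1, M.2.1, M.2.2⟩
  let e₂ : (Σ S : {S : {S : Subring (Π i, L i) // 𝔯 ≤ S} // (S : Subring (Π i, L i)) ∈ hT.toFinset}, F S) ≃
      Σ S : {S : Subring (Π i, L i) // 𝔯 ≤ S}, F S :=
    Equiv.sigmaSubtypeEquivOfSubset F (fun S => (S : Subring (Π i, L i)) ∈ hT.toFinset) hq
  -- reindex by the finite set itself
  let ι₁ : {S : Subring (Π i, L i) // S ∈ hT.toFinset} →
      {S : {S : Subring (Π i, L i) // 𝔯 ≤ S} // (S : Subring (Π i, L i)) ∈ hT.toFinset} :=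
    fun S => ⟨⟨S.1, ((Set.Finite.mem_toFinset hT).1 S.2).1⟩, S.2⟩
  have hι₁ : Function.Bijective ι₁ :=
    ⟨fun S S' h => Subtype.ext (congrArg (fun x => ((x.1 : {S : Subring (Π i, L i) // 𝔯 ≤ S}) : Subring (Π i, L i))) h),
      fun S => ⟨⟨S.1.1, S.2⟩, rfl⟩⟩
  let e₃ : (Σ S : {S : Subring (Π i, L i) // S ∈ hT.toFinset}, F (ι₁ S).1) ≃
      Σ S : {S : {S : Subring (Π i, L i) // 𝔯 ≤ S} // (S : Subring (Π i, L i)) ∈ hT.toFinset}, F S.1 :=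
    Equiv.sigmaCongrLeft
      (β := fun S : {S : {S : Subring (Π i, L i) // 𝔯 ≤ S} // (S : Subring (Π i, L i)) ∈ hT.toFinset} => F S.1)
      (Equiv.ofBijective ι₁ hι₁)
  haveI : ∀ S : {S : Subring (Π i, L i) // S ∈ hT.toFinset}, Finite (F (ι₁ S).1) := fun S =>
    IsCMAlgTorusRat.finite_quot_isFullLattice_order_eq (L := L) S.1
  rw [Nat.card_congr (e.trans (e₂.symm.trans e₃.symm)), Nat.card_sigma, Finset.sum_coe_sort hT.toFinset
    (fun S => Nat.card (Quot (fun M M' : {M : Submodule ℤ (Π i, L i) //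
        IsFullLattice (Π i, L i) M ∧ ∀ a : Π i, L i, (∀ m ∈ M, m * a ∈ M) ↔ a ∈ S} =>
      ∃ u : (Π i, L i)ˣ, u • (M : Submodule ℤ (Π i, L i)) = M')))]

end Partition

/-! ## §4 The tori: the classes with order `⊇ 𝔯` are the disjoint union of the classes with order `= S`, `S ⊇ 𝔯` -/

namespace IsCMAlgTorusRat

section Tori

variable {t : Type} {L : t → Type} [∀ i, Field (L i)] [∀ i, NumberField (L i)] [Fintype t] [DecidableEq t]
variable {ι : Type} [Fintype ι] [DecidableEq ι] {E₀ : Type} [NormedAddCommGroup E₀] [NormedSpace ℂ E₀]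
  {P₀ : (ι → ℝ) ≃L[ℝ] E₀} {ρ₀ : (Π i, L i) →ₐ[ℚ] Matrix ι ι ℚ} {q₀ : (Π i, L i) ≃ₗ[ℚ] (ι → ℚ)}

/-- **THE `Y`-ISOMORPHISM CLASSES WITH ORDER `⊇ 𝔯` ARE PARTITIONED BY THEIR EXACT ORDER**: for a reference structure
`(X₀, ρ₀)` of type `(Y; (Φᵢ))` with coordinate `q₀` and ANY subring `𝔯 ⊂ Y`, the `Y`-isomorphism classes of the
models `(X_A, ρ_A)` whose order `ρ_A⁻¹(M_ι(ℤ))` contains `𝔯` are in bijection with the disjoint union, over the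
subrings `S ⊇ 𝔯`, of the classes whose order IS `S` («we call `𝔯` the order of `(A, ι)`» — an isomorphism invariant,
g31-#2 `order_eq_of_equivariant_iso`; «`ICM(R) = ⊔_S ICM_S(R)`» through the dictionaries of g31-#2).
[cite: Shimura1998, §7.1 («the order of `(A, ι)`»), p. 47] [cite: Marseglia2019, §3–§4, pp. 6–8] [cite: HertlingLarabi2026, §6 Thms. 6.3, 6.5, chunk p0015] -/
theorem nonempty_quot_sublattice_le_order_equiv_sigma (h₀ : IsCMAlgTorusRat P₀ ρ₀)
    (hq₀ : ∀ a y, q₀ (a * y) = ρ₀ a *ᵥ q₀ y) (𝔯 : Subring (Π i, L i)) :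
    Nonempty (Quot (fun A B : {A : Matrix ι ι ℤ // A.det ≠ 0 ∧
          ∀ ρ_A : (Π i, L i) →ₐ[ℚ] Matrix ι ι ℚ,
            (∀ a, A.map (Int.cast : ℤ → ℚ) * ρ_A a = ρ₀ a * A.map (Int.cast : ℤ → ℚ)) →
            𝔯 ≤ (intMatrixSubring ι).comap (ρ_A : (Π i, L i) →+* Matrix ι ι ℚ)} =>
        ∃ R R' : Matrix ι ι ℤ, R' * R = 1 ∧ R * R' = 1 ∧
          ∀ ρ_A ρ_B : (Π i, L i) →ₐ[ℚ] Matrix ι ι ℚ,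
            (∀ a, (A : Matrix ι ι ℤ).map (Int.cast : ℤ → ℚ) * ρ_A a = ρ₀ a * (A : Matrix ι ι ℤ).map (Int.cast : ℤ → ℚ)) →
            (∀ a, (B : Matrix ι ι ℤ).map (Int.cast : ℤ → ℚ) * ρ_B a = ρ₀ a * (B : Matrix ι ι ℤ).map (Int.cast : ℤ → ℚ)) →
            ∀ a, R.map (Int.cast : ℤ → ℚ) * ρ_A a = ρ_B a * R.map (Int.cast : ℤ → ℚ)) ≃
      Σ S : {S : Subring (Π i, L i) // 𝔯 ≤ S}, Quot (fun A B : {A : Matrix ι ι ℤ // A.det ≠ 0 ∧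
          ∀ ρ_A : (Π i, L i) →ₐ[ℚ] Matrix ι ι ℚ,
            (∀ a, A.map (Int.cast : ℤ → ℚ) * ρ_A a = ρ₀ a * A.map (Int.cast : ℤ → ℚ)) →
            (intMatrixSubring ι).comap (ρ_A : (Π i, L i) →+* Matrix ι ι ℚ) = (S : Subring (Π i, L i))} =>
        ∃ R R' : Matrix ι ι ℤ, R' * R = 1 ∧ R * R' = 1 ∧
          ∀ ρ_A ρ_B : (Π i, L i) →ₐ[ℚ] Matrix ι ι ℚ,
            (∀ a, (A : Matrix ι ι ℤ).map (Int.cast : ℤ → ℚ) * ρ_A a = ρ₀ a * (A : Matrix ι ι ℤ).map (Int.cast : ℤ → ℚ)) →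
            (∀ a, (B : Matrix ι ι ℤ).map (Int.cast : ℤ → ℚ) * ρ_B a = ρ₀ a * (B : Matrix ι ι ℤ).map (Int.cast : ℤ → ℚ)) →
            ∀ a, R.map (Int.cast : ℤ → ℚ) * ρ_A a = ρ_B a * R.map (Int.cast : ℤ → ℚ))) := by
  obtain ⟨e₁⟩ := h₀.nonempty_quot_sublattice_le_order_equiv hq₀ 𝔯
  obtain ⟨e₂⟩ := nonempty_quot_le_equiv_sigma_quot_order_eq (L := L) 𝔯
  have e₃ := fun S : {S : Subring (Π i, L i) // 𝔯 ≤ S} =>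
    (h₀.nonempty_quot_sublattice_order_eq_equiv hq₀ (S : Subring (Π i, L i))).some
  exact ⟨e₁.trans (e₂.trans (Equiv.sigmaCongrRight fun S => (e₃ S).symm))⟩

/-- **COUNTED: `#`(classes with order `⊇ 𝔯`) `= Σ_{S ∈ 𝓢} #`(classes with order `= S`) for a finite set `𝓢` of
over-orders `S ⊇ 𝔯`**, whenever `𝔯 ⊇ n𝒪_Y` (`n ≠ 0` — automatic for the order of a structure): the `Y`-isomorphism
classes of CM-algebra tori with order containing `𝔯` are counted over-order by over-order («`#ICM(R) = Σ_S #ICM_S(R)`»;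
finitely many `S` by «between `Λ` and `Λ_max` there are only finitely many orders»). [cite: Marseglia2019, §3–§4, pp. 6–8] [cite: HertlingLarabi2026, §6 Rem. 6.6 (i), chunk p0015]
[cite: Shimura1998, §7.1, p. 47; §7.4 Prop. 17, p. 58] -/
theorem exists_finset_natCard_quot_sublattice_le_order_eq_sum (h₀ : IsCMAlgTorusRat P₀ ρ₀)
    (hq₀ : ∀ a y, q₀ (a * y) = ρ₀ a *ᵥ q₀ y) (𝔯 : Subring (Π i, L i)) {n : ℤ} (hn : n ≠ 0)
    (hn𝔯 : ∀ a : Π i, L i, (∀ i, IsIntegral ℤ (a i)) → n • a ∈ 𝔯) :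
    ∃ 𝓢 : Finset (Subring (Π i, L i)), (∀ S ∈ 𝓢, 𝔯 ≤ S) ∧
      Nat.card (Quot (fun A B : {A : Matrix ι ι ℤ // A.det ≠ 0 ∧
          ∀ ρ_A : (Π i, L i) →ₐ[ℚ] Matrix ι ι ℚ,
            (∀ a, A.map (Int.cast : ℤ → ℚ) * ρ_A a = ρ₀ a * A.map (Int.cast : ℤ → ℚ)) →
            𝔯 ≤ (intMatrixSubring ι).comap (ρ_A : (Π i, L i) →+* Matrix ι ι ℚ)} =>
        ∃ R R' : Matrix ι ι ℤ, R' * R = 1 ∧ R * R' = 1 ∧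
          ∀ ρ_A ρ_B : (Π i, L i) →ₐ[ℚ] Matrix ι ι ℚ,
            (∀ a, (A : Matrix ι ι ℤ).map (Int.cast : ℤ → ℚ) * ρ_A a = ρ₀ a * (A : Matrix ι ι ℤ).map (Int.cast : ℤ → ℚ)) →
            (∀ a, (B : Matrix ι ι ℤ).map (Int.cast : ℤ → ℚ) * ρ_B a = ρ₀ a * (B : Matrix ι ι ℤ).map (Int.cast : ℤ → ℚ)) →
            ∀ a, R.map (Int.cast : ℤ → ℚ) * ρ_A a = ρ_B a * R.map (Int.cast : ℤ → ℚ))) =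
      ∑ S ∈ 𝓢, Nat.card (Quot (fun A B : {A : Matrix ι ι ℤ // A.det ≠ 0 ∧
          ∀ ρ_A : (Π i, L i) →ₐ[ℚ] Matrix ι ι ℚ,
            (∀ a, A.map (Int.cast : ℤ → ℚ) * ρ_A a = ρ₀ a * A.map (Int.cast : ℤ → ℚ)) →
            (intMatrixSubring ι).comap (ρ_A : (Π i, L i) →+* Matrix ι ι ℚ) = S} =>
        ∃ R R' : Matrix ι ι ℤ, R' * R = 1 ∧ R * R' = 1 ∧
          ∀ ρ_A ρ_B : (Π i, L i) →ₐ[ℚ] Matrix ι ι ℚ,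
            (∀ a, (A : Matrix ι ι ℤ).map (Int.cast : ℤ → ℚ) * ρ_A a = ρ₀ a * (A : Matrix ι ι ℤ).map (Int.cast : ℤ → ℚ)) →
            (∀ a, (B : Matrix ι ι ℤ).map (Int.cast : ℤ → ℚ) * ρ_B a = ρ₀ a * (B : Matrix ι ι ℤ).map (Int.cast : ℤ → ℚ)) →
            ∀ a, R.map (Int.cast : ℤ → ℚ) * ρ_A a = ρ_B a * R.map (Int.cast : ℤ → ℚ))) := by
  obtain ⟨𝓢, h𝓢, hsum⟩ := exists_finset_natCard_quot_le_eq_sum (L := L) 𝔯 hn hn𝔯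
  refine ⟨𝓢, h𝓢, ?_⟩
  rw [h₀.natCard_quot_sublattice_le_order_eq hq₀ 𝔯, hsum]
  refine Finset.sum_congr rfl fun S _ => ?_
  exact (Nat.card_congr (h₀.nonempty_quot_sublattice_order_eq_equiv hq₀ S).some).symm

end Tori

end IsCMAlgTorusRat

end Literature.NumberTheory.ComplexMultiplication
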